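import Literature.NumberTheory.Transcendental.TubbsPeriodsFunction
import Literature.NumberTheory.Transcendental.ChudnovskyValues
import HarnessLib

/-!
# Tubbs 1990, Theorem 4 (periods form) — degrees and heights of the formal values

Topic `Literature/NumberTheory/Transcendental` (trunk T-TRANSCEND). Second file of the discharge of
`Literature.NumberTheory.Transcendental.Tubbs1990_thm4_periods` (Tubbs 1990, Thm 4 = Chudnovsky
1984, Ch. 7, Thm 4.1 (i)), companion of `TubbsPeriodsFunction.lean` (the polynomials `V t n l`)
and `ChudnovskyValues.lean` (generic bookkeeping for derivations `mkDerivation ℤ f`).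

The arithmetic half of Gel'fond's method needs crude bounds for the degrees and the heights of
the integer polynomials `V t n (i,j,k) = a₃^{n₁j} a₄^{n₂j} · (E_j^t (X₀ⁱX₁ᵏ))(n₁a₀+n₂a₁, 0, 0; a)`
(Chudnovsky 1984, Ch. 7, §2, p. 306: "`d(P) ≤ c₁ D`; `H(P) ≤ exp(c₂ D log D)`"). Here
`E_j = D₀ + j·a₂` is a derivation plus multiplication by a polynomial of degree `1`, so one
application raises the degree by at most `1` and multiplies the `ℓ¹`-norm by at most
`25 · deg + j` (`25` bounds the `ℓ¹`-norms of the values of `D₀`); the substitution at `z_n`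
has values of degree `≤ 1` and `ℓ¹`-norm `≤ n₁ + n₂ + 1`.

## Contents (no definitions)

* `totalDegree_twist_le`, `l1_twist_le`, `totalDegree_twist_pow_le`, `l1_twist_pow_le` —
  generic bounds for `E = mkDerivation ℤ f + (P₀ · )`, `deg P₀ ≤ 1`.
* `totalDegree_V_le` : `deg (V t n (i,j,k)) ≤ (n₁ + n₂) j + (i + k + t)`;
  `degree_le_of_mem_support_V`;
* `l1_V_le` : `l1 (V t n (i,j,k)) ≤ (25 (i + k + t) + j)^t (n₁ + n₂ + 1)^{i + k + t}`.

## References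

* G. V. Chudnovsky, *Contributions to the theory of transcendental numbers* (1984), Ch. 7 §2
  p. 306 and Thm 4.1 (i) p. 318. [Chudnovsky1984]
* R. Tubbs, J. Number Theory 35 (1990), Thm 4 (p. 112). [Tubbs1990]
-/

noncomputable section

open MvPolynomial Finset

namespace Literature.NumberTheory.Transcendental.TubbsPeriods

open Literature.NumberTheory.Transcendental.Chudnovsky (l1 wnorm wnorm_add_le wnorm_mul_le
  wnorm_nonneg wnorm_X wnorm_X_pow_le wnorm_C wnorm_zero normRingSeminorm_int_one
  normRingSeminorm_int_apply totalDegree_mkDerivation_le l1_mkDerivation_le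
  totalDegree_aeval_le_of_le_one l1_aeval_le)

/-! ### Generic bounds for a twisted derivation `E = D_f + P₀` -/

section Generic

variable {σ : Type*} (f : σ → MvPolynomial σ ℤ) (P₀ : MvPolynomial σ ℤ) {B B₀ : ℝ}

/-- The twisted operator `E = D_f + (P₀ · )` as a linear map. [folklore] -/
abbrev twist : MvPolynomial σ ℤ →ₗ[ℤ] MvPolynomial σ ℤ :=
  (MvPolynomial.mkDerivation ℤ f).toLinearMap + LinearMap.mulLeft ℤ P₀

/-- **Degree under the twisted operator.** If all `deg (f s) ≤ 2` and `deg P₀ ≤ 1` then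
`deg (E Q) ≤ deg Q + 1`. [folklore] -/
theorem totalDegree_twist_le (hf : ∀ s, (f s).totalDegree ≤ 2) (hP₀ : P₀.totalDegree ≤ 1)
    (Q : MvPolynomial σ ℤ) : (twist f P₀ Q).totalDegree ≤ Q.totalDegree + 1 := by
  change (MvPolynomial.mkDerivation ℤ f Q + P₀ * Q).totalDegree ≤ Q.totalDegree + 1
  refine (totalDegree_add _ _).trans (max_le (totalDegree_mkDerivation_le f hf Q) ?_)
  refine (totalDegree_mul _ _).trans ?_
  omega

/-- **Height under the twisted operator.** If all `l1 (f s) ≤ B` and `l1 P₀ ≤ B₀` then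
`l1 (E Q) ≤ (B · deg Q + B₀) · l1 Q`. [folklore] -/
theorem l1_twist_le (hB : 0 ≤ B) (hf : ∀ s, l1 (f s) ≤ B) (hP₀ : l1 P₀ ≤ B₀)
    (Q : MvPolynomial σ ℤ) : l1 (twist f P₀ Q) ≤ (B * Q.totalDegree + B₀) * l1 Q := by
  change l1 (MvPolynomial.mkDerivation ℤ f Q + P₀ * Q) ≤ (B * Q.totalDegree + B₀) * l1 Q
  refine (wnorm_add_le _ _ _).trans ?_
  have h1 : l1 (MvPolynomial.mkDerivation ℤ f Q) ≤ B * Q.totalDegree * l1 Q :=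
    l1_mkDerivation_le f hB hf Q
  have h2 : l1 (P₀ * Q) ≤ B₀ * l1 Q :=
    (wnorm_mul_le _ _ _).trans (mul_le_mul_of_nonneg_right hP₀ (wnorm_nonneg _ _))
  unfold l1 at h1 h2 ⊢
  nlinarith

/-- Degree of the iterates: `deg (E^t Q) ≤ deg Q + t`. [folklore] -/
theorem totalDegree_twist_pow_le (hf : ∀ s, (f s).totalDegree ≤ 2) (hP₀ : P₀.totalDegree ≤ 1)
    (t : ℕ) (Q : MvPolynomial σ ℤ) :
    (((twist f P₀) ^ t) Q).totalDegree ≤ Q.totalDegree + t := by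
  induction t with
  | zero => simp
  | succ t ih =>
    rw [pow_succ', Module.End.mul_apply]
    exact (totalDegree_twist_le f P₀ hf hP₀ _).trans (by omega)

/-- Height of the iterates: `l1 (E^t Q) ≤ (B (deg Q + t) + B₀)^t · l1 Q` (`B, B₀ ≥ 0`).
[folklore] -/
theorem l1_twist_pow_le (hB : 0 ≤ B) (hB₀ : 0 ≤ B₀) (hf : ∀ s, l1 (f s) ≤ B)
    (hf' : ∀ s, (f s).totalDegree ≤ 2) (hP₀ : l1 P₀ ≤ B₀) (hP₀' : P₀.totalDegree ≤ 1)
    (t : ℕ) (Q : MvPolynomial σ ℤ) :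
    l1 (((twist f P₀) ^ t) Q) ≤ (B * (Q.totalDegree + t) + B₀) ^ t * l1 Q := by
  induction t with
  | zero => simp
  | succ t ih =>
    rw [pow_succ', Module.End.mul_apply]
    set P := ((twist f P₀) ^ t) Q
    have hdeg : (P.totalDegree : ℝ) ≤ Q.totalDegree + t := by
      exact_mod_cast totalDegree_twist_pow_le f P₀ hf' hP₀' t Q
    have hl1P : 0 ≤ l1 P := wnorm_nonneg _ _
    have hl1Q : 0 ≤ l1 Q := wnorm_nonneg _ _
    set K : ℝ := B * (Q.totalDegree + (t + 1 : ℕ)) + B₀ with hK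
    have hK0 : 0 ≤ B * (Q.totalDegree + t) + B₀ := by positivity
    have hstep : B * P.totalDegree + B₀ ≤ K := by
      rw [hK]; push_cast; nlinarith
    have hold : B * (Q.totalDegree + t) + B₀ ≤ K := by
      rw [hK]; push_cast; nlinarith
    calc l1 (twist f P₀ P) ≤ (B * P.totalDegree + B₀) * l1 P := l1_twist_le f P₀ hB hf hP₀ P
      _ ≤ K * ((B * (Q.totalDegree + t) + B₀) ^ t * l1 Q) :=
          mul_le_mul hstep ih hl1P (hK0.trans hold)
      _ ≤ K * (K ^ t * l1 Q) := by
          refine mul_le_mul_of_nonneg_left ?_ (hK0.trans hold)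
          exact mul_le_mul_of_nonneg_right (pow_le_pow_left₀ hK0 hold t) hl1Q
      _ = K ^ (t + 1) * l1 Q := by rw [pow_succ]; ring

end Generic

/-! ### The bounds for `V t n l` -/

/-- The values of `D₀` on the variables have degree `≤ 2`. [folklore] -/
lemma totalDegree_dval_le (s' : Fin 3 ⊕ Fin 7) : (dval s').totalDegree ≤ 2 := by
  rcases s' with s' | l
  · fin_cases s'
    · change (1 : RX).totalDegree ≤ 2
      rw [totalDegree_one]; norm_num
    · change (X (Sum.inl 2) : RX).totalDegree ≤ 2
      rw [totalDegree_X]; norm_num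
    · change (6 * X (Sum.inl 1) ^ 2 + 12 * X (Sum.inr 5) * X (Sum.inl 1) +
        6 * X (Sum.inr 5) ^ 2 - X (Sum.inr 6) : RX).totalDegree ≤ 2
      refine (totalDegree_sub _ _).trans (max_le ?_ ?_)
      · refine (totalDegree_add _ _).trans (max_le ((totalDegree_add _ _).trans (max_le ?_ ?_)) ?_)
        · refine (totalDegree_mul _ _).trans ?_
          rw [show (6 : RX) = C 6 from (map_ofNat C 6).symm, totalDegree_C, totalDegree_X_pow]
        · calc (12 * X (Sum.inr 5) * X (Sum.inl 1) : RX).totalDegree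
              ≤ (12 * X (Sum.inr 5) : RX).totalDegree + (X (Sum.inl 1) : RX).totalDegree :=
                totalDegree_mul _ _
            _ ≤ ((12 : RX).totalDegree + (X (Sum.inr 5) : RX).totalDegree) +
                (X (Sum.inl 1) : RX).totalDegree := by
                gcongr; exact totalDegree_mul _ _
            _ = 2 := by
                rw [show (12 : RX) = C 12 from (map_ofNat C 12).symm, totalDegree_C, totalDegree_X,
                  totalDegree_X]
        · refine (totalDegree_mul _ _).trans ?_
          rw [show (6 : RX) = C 6 from (map_ofNat C 6).symm, totalDegree_C, totalDegree_X_pow]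
      · rw [totalDegree_X]; norm_num
  · change (0 : RX).totalDegree ≤ 2
    rw [totalDegree_zero]; norm_num

/-- The values of `D₀` on the variables have `ℓ¹`-norm `≤ 25`. [folklore] -/
lemma l1_dval_le (s' : Fin 3 ⊕ Fin 7) : l1 (dval s') ≤ 25 := by
  have hX : ∀ v : Fin 3 ⊕ Fin 7, wnorm (normRingSeminorm ℤ) (X v : RX) = 1 := fun v => by
    rw [wnorm_X, normRingSeminorm_int_one]
  have hXpow : ∀ (v : Fin 3 ⊕ Fin 7) (m : ℕ), wnorm (normRingSeminorm ℤ) ((X v : RX) ^ m) ≤ 1 :=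
    fun v m => wnorm_X_pow_le (normRingSeminorm ℤ) (by simp) v m
  have h6 : wnorm (normRingSeminorm ℤ) (6 : RX) = 6 := by
    rw [show (6 : RX) = C 6 from (map_ofNat C 6).symm, wnorm_C, normRingSeminorm_int_apply]
    norm_num
  have h12 : wnorm (normRingSeminorm ℤ) (12 : RX) = 12 := by
    rw [show (12 : RX) = C 12 from (map_ofNat C 12).symm, wnorm_C, normRingSeminorm_int_apply]
    norm_num
  rcases s' with s' | l
  · fin_cases s'
    · change wnorm (normRingSeminorm ℤ) (1 : RX) ≤ 25
      rw [Chudnovsky.wnorm_one, normRingSeminorm_int_one]; norm_num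
    · change wnorm (normRingSeminorm ℤ) (X (Sum.inl 2) : RX) ≤ 25
      rw [hX]; norm_num
    · change wnorm (normRingSeminorm ℤ) (6 * X (Sum.inl 1) ^ 2 + 12 * X (Sum.inr 5) * X (Sum.inl 1) +
        6 * X (Sum.inr 5) ^ 2 - X (Sum.inr 6) : RX) ≤ 25
      have t1 : wnorm (normRingSeminorm ℤ) (6 * X (Sum.inl 1) ^ 2 : RX) ≤ 6 := by
        refine (wnorm_mul_le _ _ _).trans ?_
        rw [h6]
        have := hXpow (Sum.inl 1) 2
        nlinarith [wnorm_nonneg (normRingSeminorm ℤ) ((X (Sum.inl 1) : RX) ^ 2)]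
      have t2 : wnorm (normRingSeminorm ℤ) (12 * X (Sum.inr 5) * X (Sum.inl 1) : RX) ≤ 12 := by
        refine (wnorm_mul_le _ _ _).trans ?_
        rw [hX]
        refine (mul_le_mul_of_nonneg_right (wnorm_mul_le _ _ _) zero_le_one).trans ?_
        rw [h12, hX]; norm_num
      have t3 : wnorm (normRingSeminorm ℤ) (6 * X (Sum.inr 5) ^ 2 : RX) ≤ 6 := by
        refine (wnorm_mul_le _ _ _).trans ?_
        rw [h6]
        have := hXpow (Sum.inr 5) 2
        nlinarith [wnorm_nonneg (normRingSeminorm ℤ) ((X (Sum.inr 5) : RX) ^ 2)]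
      have t4 := hX (Sum.inr 6)
      refine (Chudnovsky.wnorm_sub_le _ _ _).trans ?_
      refine (add_le_add ((wnorm_add_le _ _ _).trans (add_le_add ((wnorm_add_le _ _ _).trans
        (add_le_add t1 t2)) t3)) (le_of_eq t4)).trans ?_
      norm_num
  · change wnorm (normRingSeminorm ℤ) (0 : RX) ≤ 25
    rw [wnorm_zero]; norm_num

/-- The multiplier `j·a₂` of the twist has degree `≤ 1`. [folklore] -/
lemma totalDegree_twistPoly_le (j : ℕ) : ((j : RX) * X (Sum.inr 2)).totalDegree ≤ 1 := by
  refine (totalDegree_mul _ _).trans ?_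
  rw [show (j : RX) = C (j : ℤ) from (map_natCast C j).symm, totalDegree_C, totalDegree_X]

/-- The multiplier `j·a₂` of the twist has `ℓ¹`-norm `≤ j`. [folklore] -/
lemma l1_twistPoly_le (j : ℕ) : l1 ((j : RX) * X (Sum.inr 2)) ≤ j := by
  refine (wnorm_mul_le _ _ _).trans ?_
  rw [show (j : RX) = C (j : ℤ) from (map_natCast C j).symm, wnorm_C, wnorm_X,
    normRingSeminorm_int_apply, normRingSeminorm_int_one]
  simp

/-- `E₀ j` is the generic twist of `D₀ = mkDerivation ℤ dval` by `j·a₂`. [folklore] -/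
lemma E₀_eq_twist (j : ℕ) : E₀ j = twist dval ((j : RX) * X (Sum.inr 2)) := rfl

/-- The substitution `sval n` has values of degree `≤ 1`. [folklore] -/
lemma totalDegree_sval_le (n : ℕ × ℕ) (s' : Fin 3 ⊕ Fin 7) : (sval n s').totalDegree ≤ 1 := by
  rcases s' with s' | l
  · fin_cases s'
    · change ((n.1 : RA) * X 0 + (n.2 : RA) * X 1).totalDegree ≤ 1
      refine (totalDegree_add _ _).trans (max_le ?_ ?_)
      · refine (totalDegree_mul _ _).trans ?_
        rw [show (n.1 : RA) = C (n.1 : ℤ) from (map_natCast C n.1).symm, totalDegree_C,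
          totalDegree_X]
      · refine (totalDegree_mul _ _).trans ?_
        rw [show (n.2 : RA) = C (n.2 : ℤ) from (map_natCast C n.2).symm, totalDegree_C,
          totalDegree_X]
    · change (0 : RA).totalDegree ≤ 1
      rw [totalDegree_zero]; norm_num
    · change (0 : RA).totalDegree ≤ 1
      rw [totalDegree_zero]; norm_num
  · change (X l : RA).totalDegree ≤ 1
    rw [totalDegree_X]

/-- The substitution `sval n` has values of `ℓ¹`-norm `≤ n₁ + n₂ + 1`. [folklore] -/
lemma l1_sval_le (n : ℕ × ℕ) (s' : Fin 3 ⊕ Fin 7) : l1 (sval n s') ≤ (n.1 : ℝ) + n.2 + 1 := by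
  have h0 : (0 : ℝ) ≤ n.1 := Nat.cast_nonneg _
  have h0' : (0 : ℝ) ≤ n.2 := Nat.cast_nonneg _
  rcases s' with s' | l
  · fin_cases s'
    · change l1 ((n.1 : RA) * X 0 + (n.2 : RA) * X 1) ≤ (n.1 : ℝ) + n.2 + 1
      have h1 : wnorm (normRingSeminorm ℤ) ((n.1 : RA) * X 0) ≤ n.1 := by
        refine (wnorm_mul_le _ _ _).trans ?_
        rw [show (n.1 : RA) = C (n.1 : ℤ) from (map_natCast C n.1).symm, wnorm_C, wnorm_X,
          normRingSeminorm_int_apply, normRingSeminorm_int_one]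
        simp
      have h2 : wnorm (normRingSeminorm ℤ) ((n.2 : RA) * X 1) ≤ n.2 := by
        refine (wnorm_mul_le _ _ _).trans ?_
        rw [show (n.2 : RA) = C (n.2 : ℤ) from (map_natCast C n.2).symm, wnorm_C, wnorm_X,
          normRingSeminorm_int_apply, normRingSeminorm_int_one]
        simp
      refine (wnorm_add_le _ _ _).trans ?_
      linarith
    · change l1 (0 : RA) ≤ (n.1 : ℝ) + n.2 + 1
      rw [l1, wnorm_zero]; positivity
    · change l1 (0 : RA) ≤ (n.1 : ℝ) + n.2 + 1
      rw [l1, wnorm_zero]; positivity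
  · change l1 (X l : RA) ≤ (n.1 : ℝ) + n.2 + 1
    rw [l1, wnorm_X, normRingSeminorm_int_one]; linarith

/-- The monomial `X₀ⁱ X₁ᵏ` has degree `≤ i + k`. [folklore] -/
lemma totalDegree_monoX_le (i k : ℕ) :
    (X (Sum.inl 0) ^ i * X (Sum.inl 1) ^ k : RX).totalDegree ≤ i + k :=
  (totalDegree_mul _ _).trans (by rw [totalDegree_X_pow, totalDegree_X_pow])

/-- `l1 (X₀ⁱ X₁ᵏ) ≤ 1`. [folklore] -/
lemma l1_monoX_le (i k : ℕ) : l1 (X (Sum.inl 0) ^ i * X (Sum.inl 1) ^ k : RX) ≤ 1 := by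
  refine (wnorm_mul_le _ _ _).trans ?_
  have h1 := wnorm_X_pow_le (normRingSeminorm ℤ) (by simp) (Sum.inl 0 : Fin 3 ⊕ Fin 7) i
  have h2 := wnorm_X_pow_le (normRingSeminorm ℤ) (by simp) (Sum.inl 1 : Fin 3 ⊕ Fin 7) k
  have h0 := wnorm_nonneg (normRingSeminorm ℤ) ((X (Sum.inl 0) : RX) ^ i)
  nlinarith

variable {La L0 L1 : ℕ}

/-- Degree of the derivative part: `deg (E_j^t (X₀ⁱX₁ᵏ)) ≤ i + k + t`. [folklore] -/
lemma totalDegree_E₀_pow_monoX_le (j t i k : ℕ) :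
    (((E₀ j) ^ t) (X (Sum.inl 0) ^ i * X (Sum.inl 1) ^ k : RX)).totalDegree ≤ i + k + t := by
  rw [E₀_eq_twist]
  refine (totalDegree_twist_pow_le dval _ totalDegree_dval_le (totalDegree_twistPoly_le j) t
    _).trans ?_
  have := totalDegree_monoX_le i k
  omega

/-- **Degree bound**: `deg (V t n (i,j,k)) ≤ (n₁ + n₂) j + (i + k + t)`.
[cite: Chudnovsky1984, Ch. 7 §2 p. 306] -/
theorem totalDegree_V_le (t : ℕ) (n : ℕ × ℕ) (l : Lam La L0 L1) :
    (V t n l).totalDegree ≤ (n.1 + n.2) * (l.2.1 : ℕ) + ((l.1 : ℕ) + (l.2.2 : ℕ) + t) := by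
  unfold V
  refine (totalDegree_mul _ _).trans ?_
  refine add_le_add ((totalDegree_mul _ _).trans ?_) ?_
  · rw [totalDegree_X_pow, totalDegree_X_pow, add_mul]
  · refine (totalDegree_aeval_le_of_le_one _ (totalDegree_sval_le n) _).trans ?_
    exact totalDegree_E₀_pow_monoX_le _ t l.1 l.2.2

/-- The same, monomial-wise: every monomial of `V t n l` has degree
`≤ (n₁ + n₂) j + (i + k + t)`. [cite: Chudnovsky1984, Ch. 7 §2 p. 306] -/
theorem degree_le_of_mem_support_V (t : ℕ) (n : ℕ × ℕ) (l : Lam La L0 L1) {α : Fin 7 →₀ ℕ}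
    (hα : α ∈ (V t n l).support) :
    α.degree ≤ (n.1 + n.2) * (l.2.1 : ℕ) + ((l.1 : ℕ) + (l.2.2 : ℕ) + t) :=
  (le_totalDegree hα : α.degree ≤ (V t n l).totalDegree).trans (totalDegree_V_le t n l)

/-- **Height bound**: `l1 (V t n (i,j,k)) ≤ (25 (i + k + t) + j)^t (n₁ + n₂ + 1)^{i + k + t}`.
[cite: Chudnovsky1984, Ch. 7 §2 p. 306] -/
theorem l1_V_le (t : ℕ) (n : ℕ × ℕ) (l : Lam La L0 L1) :
    l1 (V t n l) ≤ (25 * (((l.1 : ℕ) : ℝ) + (l.2.2 : ℕ) + t) + (l.2.1 : ℕ)) ^ t *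
      ((n.1 : ℝ) + n.2 + 1) ^ ((l.1 : ℕ) + (l.2.2 : ℕ) + t) := by
  unfold V
  set i : ℕ := (l.1 : ℕ)
  set j : ℕ := (l.2.1 : ℕ)
  set k : ℕ := (l.2.2 : ℕ)
  set Q : RX := X (Sum.inl 0) ^ i * X (Sum.inl 1) ^ k with hQ
  set P : RX := ((E₀ j) ^ t) Q with hP
  have hM : (1 : ℝ) ≤ (n.1 : ℝ) + n.2 + 1 := by
    linarith [(Nat.cast_nonneg n.1 : (0 : ℝ) ≤ n.1), (Nat.cast_nonneg n.2 : (0 : ℝ) ≤ n.2)]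
  have hdegP : P.totalDegree ≤ i + k + t := totalDegree_E₀_pow_monoX_le j t i k
  have hl1P : l1 P ≤ (25 * ((i : ℝ) + k + t) + j) ^ t := by
    rw [hP, E₀_eq_twist]
    refine (l1_twist_pow_le dval _ (by norm_num) (Nat.cast_nonneg j) l1_dval_le totalDegree_dval_le
      (l1_twistPoly_le j) (totalDegree_twistPoly_le j) t Q).trans ?_
    have hQdeg : (Q.totalDegree : ℝ) ≤ i + k := by exact_mod_cast totalDegree_monoX_le i k
    have hQl1 : l1 Q ≤ 1 := l1_monoX_le i k
    have h0 : 0 ≤ (25 * ((Q.totalDegree : ℝ) + t) + j) ^ t := by positivity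
    calc (25 * ((Q.totalDegree : ℝ) + t) + j) ^ t * l1 Q
        ≤ (25 * ((Q.totalDegree : ℝ) + t) + j) ^ t * 1 := by
          exact mul_le_mul_of_nonneg_left hQl1 h0
      _ ≤ (25 * ((i : ℝ) + k + t) + j) ^ t := by
          rw [mul_one]
          refine pow_le_pow_left₀ (by positivity) ?_ t
          linarith
  have hX3 : l1 ((X 3 : RA) ^ (n.1 * j)) ≤ 1 := wnorm_X_pow_le _ (by simp) _ _
  have hX4 : l1 ((X 4 : RA) ^ (n.2 * j)) ≤ 1 := wnorm_X_pow_le _ (by simp) _ _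
  have hA : l1 (MvPolynomial.aeval (sval n) P) ≤
      (25 * ((i : ℝ) + k + t) + j) ^ t * ((n.1 : ℝ) + n.2 + 1) ^ (i + k + t) :=
    calc l1 (MvPolynomial.aeval (sval n) P) ≤ l1 P * ((n.1 : ℝ) + n.2 + 1) ^ P.totalDegree :=
          l1_aeval_le _ hM (l1_sval_le n) P
      _ ≤ (25 * ((i : ℝ) + k + t) + j) ^ t * ((n.1 : ℝ) + n.2 + 1) ^ (i + k + t) :=
          mul_le_mul hl1P (pow_le_pow_right₀ hM hdegP) (by positivity) (by positivity)
  have hA0 : 0 ≤ l1 (MvPolynomial.aeval (sval n) P) := wnorm_nonneg _ _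
  calc l1 (X 3 ^ (n.1 * j) * X 4 ^ (n.2 * j) * MvPolynomial.aeval (sval n) P)
      ≤ l1 (X 3 ^ (n.1 * j) * X 4 ^ (n.2 * j) : RA) * l1 (MvPolynomial.aeval (sval n) P) :=
        wnorm_mul_le _ _ _
    _ ≤ 1 * l1 (MvPolynomial.aeval (sval n) P) := by
        refine mul_le_mul_of_nonneg_right ?_ hA0
        refine (wnorm_mul_le _ _ _).trans ?_
        have h0 := wnorm_nonneg (normRingSeminorm ℤ) ((X 3 : RA) ^ (n.1 * j))
        unfold l1 at hX3 hX4
        nlinarith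
    _ ≤ _ := by rw [one_mul]; exact hA

end Literature.NumberTheory.Transcendental.TubbsPeriods

end
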